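import Summits.Ventures.PercRepro2.CaseOneMoves
import Summits.Ventures.PercRepro2.CaseOnePendantT
import Summits.Ventures.PercRepro2.CaseOneA2EdgeTI

/-!
# The T-world forms survive the four thickenings; the six-form closed property
(blind cell PercRepro2, p1 g30)

The T-pair `(Dto, Dt)` is built from connection events among the marks, so it is unchanged by the
four thickenings away from the marks — leaf deletion (**`Dt_restrict`**, **`Dto_restrict`**),
parallel merge (**`Dt_merge`**, **`Dto_merge`**), series suppression (**`Dt_series`**,
**`Dto_series`**), loop deletion (**`Dt_loop`**, **`Dto_loop`**) — exactly like `Dqo`; with the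
general-pair identities `iiExprT_*` / `iExprT_*` the T-forms transfer as the Q-forms do
(`zSplitIIT_of_restrict`, …). **`ClosedAtT`** := the SIX forms `(ii), (ii-Q), (ii-T), (i), (i-Q), (i-T)`
at the statement vertex for every weight vector; **`closedAtT_of_thickStep`** /
**`closedAtT_of_thickening`** (the four thickenings), **`closedAtT_of_moveStep`** /
**`closedAtT_of_moves`** (thickenings and the pendant step, through `sixForms_of_leaf_at`), and
**`closedAtT_of_a2_edges`**: `ClosedAtT` is closed under the deletion of every `a₂a₃`-edge
(`sixForms_of_a2Free`). `ClosedAtT` implies `ClosedAt` (**`closedAt_of_closedAtT`**). So the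
six-form property is an invariant of a reduction calculus that contains the `a₂`-edge rule — the
four-form one is not known to be (P1-G30.md §2′). Own code; standard axioms.
-/

namespace Summit.Ventures.PercRepro2

namespace CaseOne

universe u

/-! ## The T-pair under the four thickenings -/

section Transfers
variable {V : Type*} {E : Type*} [Fintype E] [DecidableEq E] {R : Type*} [CommRing R]
variable {ends : E → Sym2 V} {o a₁ a₂ v b : V}

/-- `P(T)` is unchanged by deleting a leaf edge elsewhere. -/
theorem Dt_restrict {u a₃ : V} {e₀ : E} (p : E → R) (hl : IsLeafAt ends u a₃ e₀) (h1 : a₁ ≠ a₃)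
    (h2 : a₂ ≠ a₃) (hv : v ≠ a₃) :
    Dt p ends a₁ a₂ v = Dt (restrictW p e₀) (restrictEnds ends e₀) a₁ a₂ v := by
  unfold Dt
  rw [connEvent_restrict hl h2 hv, connEvent_restrict hl h1 h2]
  simp only [← Set.preimage_compl, ← Set.preimage_inter, prob_restrict]

/-- `P(T, o ∈ U)` is unchanged by deleting a leaf edge elsewhere. -/
theorem Dto_restrict {u a₃ : V} {e₀ : E} (p : E → R) (hl : IsLeafAt ends u a₃ e₀) (ho : o ≠ a₃)
    (h1 : a₁ ≠ a₃) (h2 : a₂ ≠ a₃) (hv : v ≠ a₃) :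
    Dto p ends o a₁ a₂ v = Dto (restrictW p e₀) (restrictEnds ends e₀) o a₁ a₂ v := by
  unfold Dto
  rw [connEvent_restrict hl h1 ho, connEvent_restrict hl h2 ho, connEvent_restrict hl h2 hv,
    connEvent_restrict hl h1 h2]
  simp only [← Set.preimage_compl, ← Set.preimage_inter, ← Set.preimage_union, prob_restrict]

/-- `P(T)` is unchanged by merging two parallel edges. -/
theorem Dt_merge {e₀ e₁ : E} (p : E → R) (hpar : ends e₀ = ends e₁) (hne : e₀ ≠ e₁) :
    Dt p ends a₁ a₂ v = Dt (mergeW p e₀ e₁) (restrictEnds ends e₁) a₁ a₂ v := by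
  unfold Dt
  simp only [connEvent_merge hpar hne, ← Set.preimage_compl, ← Set.preimage_inter,
    prob_merge p e₀ e₁ hne]

/-- `P(T, o ∈ U)` is unchanged by merging two parallel edges. -/
theorem Dto_merge {e₀ e₁ : E} (p : E → R) (hpar : ends e₀ = ends e₁) (hne : e₀ ≠ e₁) :
    Dto p ends o a₁ a₂ v = Dto (mergeW p e₀ e₁) (restrictEnds ends e₁) o a₁ a₂ v := by
  unfold Dto
  simp only [connEvent_merge hpar hne, ← Set.preimage_compl, ← Set.preimage_inter,
    ← Set.preimage_union, prob_merge p e₀ e₁ hne]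

/-- `P(T)` is unchanged by suppressing a series vertex `w ∉ {a₁, a₂, v}`. -/
theorem Dt_series {x w z : V} {e₀ e₁ : E} (p : E → R) (h : IsSeriesAt ends x w z e₀ e₁)
    (h1 : a₁ ≠ w) (h2 : a₂ ≠ w) (hv : v ≠ w) :
    Dt p ends a₁ a₂ v = Dt (seriesW p e₀ e₁) (seriesEnds ends e₀ e₁ x z) a₁ a₂ v := by
  unfold Dt
  rw [connEvent_series h h2 hv, connEvent_series h h1 h2]
  simp only [← Set.preimage_compl, ← Set.preimage_inter, prob_series p e₀ e₁ h.ne]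

/-- `P(T, o ∈ U)` is unchanged by suppressing a series vertex `w ∉ {o, a₁, a₂, v}`. -/
theorem Dto_series {x w z : V} {e₀ e₁ : E} (p : E → R) (h : IsSeriesAt ends x w z e₀ e₁)
    (ho : o ≠ w) (h1 : a₁ ≠ w) (h2 : a₂ ≠ w) (hv : v ≠ w) :
    Dto p ends o a₁ a₂ v = Dto (seriesW p e₀ e₁) (seriesEnds ends e₀ e₁ x z) o a₁ a₂ v := by
  unfold Dto
  rw [connEvent_series h h1 ho, connEvent_series h h2 ho, connEvent_series h h2 hv,
    connEvent_series h h1 h2]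
  simp only [← Set.preimage_compl, ← Set.preimage_inter, ← Set.preimage_union,
    prob_series p e₀ e₁ h.ne]

/-- `P(T)` is unchanged by deleting a loop. -/
theorem Dt_loop {x : V} {e₀ : E} (p : E → R) (hl : ends e₀ = s(x, x)) :
    Dt p ends a₁ a₂ v = Dt (restrictW p e₀) (restrictEnds ends e₀) a₁ a₂ v := by
  unfold Dt
  simp only [connEvent_loop hl, ← Set.preimage_compl, ← Set.preimage_inter, prob_restrict]

/-- `P(T, o ∈ U)` is unchanged by deleting a loop. -/
theorem Dto_loop {x : V} {e₀ : E} (p : E → R) (hl : ends e₀ = s(x, x)) :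
    Dto p ends o a₁ a₂ v = Dto (restrictW p e₀) (restrictEnds ends e₀) o a₁ a₂ v := by
  unfold Dto
  simp only [connEvent_loop hl, ← Set.preimage_compl, ← Set.preimage_inter, ← Set.preimage_union,
    prob_restrict]

end Transfers

section TransfersProps
variable {V : Type*} {E : Type*} [Fintype E] [DecidableEq E]
  {R : Type*} [CommRing R] [LinearOrder R]
variable {ends : E → Sym2 V} {o a₁ a₂ v b : V}

/-- `(ii-T)` at `v` in `G − e₀` gives it in `G`, for a leaf `a₃ ∉ {o, a₁, a₂, v, b}` at `e₀`. -/
theorem zSplitIIT_of_restrict {u a₃ : V} {e₀ : E} (p : E → R) (hl : IsLeafAt ends u a₃ e₀)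
    (ho : o ≠ a₃) (h1 : a₁ ≠ a₃) (h2 : a₂ ≠ a₃) (hv : v ≠ a₃) (hb : b ≠ a₃)
    (h : ZSplitIIT (restrictW p e₀) (restrictEnds ends e₀) o a₁ a₂ v b) :
    ZSplitIIT p ends o a₁ a₂ v b := by
  unfold ZSplitIIT at h ⊢
  rw [iiExprT_restrict p hl ho h1 h2 hv hb, Dto_restrict p hl ho h1 h2 hv, Dt_restrict p hl h1 h2 hv]
  exact h

/-- `(i-T)` at `v` in `G − e₀` gives it in `G`, for a leaf `a₃ ∉ {o, a₁, a₂, v, b}` at `e₀`. -/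
theorem zSplitIT_of_restrict {u a₃ : V} {e₀ : E} (p : E → R) (hl : IsLeafAt ends u a₃ e₀)
    (ho : o ≠ a₃) (h1 : a₁ ≠ a₃) (h2 : a₂ ≠ a₃) (hv : v ≠ a₃) (hb : b ≠ a₃)
    (h : ZSplitIT (restrictW p e₀) (restrictEnds ends e₀) o a₁ a₂ v b) :
    ZSplitIT p ends o a₁ a₂ v b := by
  unfold ZSplitIT at h ⊢
  rw [iExprT_restrict p hl ho h1 h2 hv hb, Dto_restrict p hl ho h1 h2 hv, Dt_restrict p hl h1 h2 hv]
  exact h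

/-- `(ii-T)` in the merged graph gives `(ii-T)` in `G`. -/
theorem zSplitIIT_of_merge {e₀ e₁ : E} (p : E → R) (hpar : ends e₀ = ends e₁) (hne : e₀ ≠ e₁)
    (h : ZSplitIIT (mergeW p e₀ e₁) (restrictEnds ends e₁) o a₁ a₂ v b) :
    ZSplitIIT p ends o a₁ a₂ v b := by
  unfold ZSplitIIT at h ⊢
  rw [iiExprT_merge p hpar hne, Dto_merge p hpar hne, Dt_merge p hpar hne]
  exact h

/-- `(i-T)` in the merged graph gives `(i-T)` in `G`. -/
theorem zSplitIT_of_merge {e₀ e₁ : E} (p : E → R) (hpar : ends e₀ = ends e₁) (hne : e₀ ≠ e₁)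
    (h : ZSplitIT (mergeW p e₀ e₁) (restrictEnds ends e₁) o a₁ a₂ v b) :
    ZSplitIT p ends o a₁ a₂ v b := by
  unfold ZSplitIT at h ⊢
  rw [iExprT_merge p hpar hne, Dto_merge p hpar hne, Dt_merge p hpar hne]
  exact h

/-- `(ii-T)` in the contracted graph gives `(ii-T)` in `G`. -/
theorem zSplitIIT_of_series {x w z : V} {e₀ e₁ : E} (p : E → R) (hs : IsSeriesAt ends x w z e₀ e₁)
    (ho : o ≠ w) (h1 : a₁ ≠ w) (h2 : a₂ ≠ w) (hv : v ≠ w) (hb : b ≠ w)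
    (h : ZSplitIIT (seriesW p e₀ e₁) (seriesEnds ends e₀ e₁ x z) o a₁ a₂ v b) :
    ZSplitIIT p ends o a₁ a₂ v b := by
  unfold ZSplitIIT at h ⊢
  rw [iiExprT_series p hs ho h1 h2 hv hb, Dto_series p hs ho h1 h2 hv, Dt_series p hs h1 h2 hv]
  exact h

/-- `(i-T)` in the contracted graph gives `(i-T)` in `G`. -/
theorem zSplitIT_of_series {x w z : V} {e₀ e₁ : E} (p : E → R) (hs : IsSeriesAt ends x w z e₀ e₁)
    (ho : o ≠ w) (h1 : a₁ ≠ w) (h2 : a₂ ≠ w) (hv : v ≠ w) (hb : b ≠ w)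
    (h : ZSplitIT (seriesW p e₀ e₁) (seriesEnds ends e₀ e₁ x z) o a₁ a₂ v b) :
    ZSplitIT p ends o a₁ a₂ v b := by
  unfold ZSplitIT at h ⊢
  rw [iExprT_series p hs ho h1 h2 hv hb, Dto_series p hs ho h1 h2 hv, Dt_series p hs h1 h2 hv]
  exact h

/-- `(ii-T)` in `G − e₀` gives `(ii-T)` in `G`, for a loop `e₀`. -/
theorem zSplitIIT_of_loop {x : V} {e₀ : E} (p : E → R) (hl : ends e₀ = s(x, x))
    (h : ZSplitIIT (restrictW p e₀) (restrictEnds ends e₀) o a₁ a₂ v b) :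
    ZSplitIIT p ends o a₁ a₂ v b := by
  unfold ZSplitIIT at h ⊢
  rw [iiExprT_loop p hl, Dto_loop p hl, Dt_loop p hl]
  exact h

/-- `(i-T)` in `G − e₀` gives `(i-T)` in `G`, for a loop `e₀`. -/
theorem zSplitIT_of_loop {x : V} {e₀ : E} (p : E → R) (hl : ends e₀ = s(x, x))
    (h : ZSplitIT (restrictW p e₀) (restrictEnds ends e₀) o a₁ a₂ v b) :
    ZSplitIT p ends o a₁ a₂ v b := by
  unfold ZSplitIT at h ⊢
  rw [iExprT_loop p hl, Dto_loop p hl, Dt_loop p hl]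
  exact h

end TransfersProps

/-! ## The six-form closed property -/

section SixForms
variable {V : Type*} {R : Type*} [Field R] [LinearOrder R] [IsStrictOrderedRing R]

/-- **The six forms at `v`** for one weight vector: `(ii), (ii-Q), (ii-T), (i), (i-Q), (i-T)`. -/
def SixForms {E : Type u} [Fintype E] [DecidableEq E] (p : E → R) (ends : E → Sym2 V)
    (o a₁ a₂ v b : V) : Prop :=
  ZSplitII p ends o a₁ a₂ v b ∧ ZSplitIIQ p ends o a₁ a₂ v b ∧ ZSplitIIT p ends o a₁ a₂ v b ∧
    ZSplitI p ends o a₁ a₂ v b ∧ ZSplitIQ p ends o a₁ a₂ v b ∧ ZSplitIT p ends o a₁ a₂ v b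

/-- **The six-form closed property**: the six forms at `v` for every admissible weight vector. -/
def ClosedAtT (o a₁ a₂ b : V) (E : Type u) [Fintype E] [DecidableEq E] (ends : E → Sym2 V) (v : V) :
    Prop :=
  ∀ p : E → R, IsProbVec p → SixForms p ends o a₁ a₂ v b

variable {o a₁ a₂ b : V}

omit [IsStrictOrderedRing R] in
/-- The six forms contain the four. -/
theorem fourForms_of_sixForms {E : Type u} [Fintype E] [DecidableEq E] {p : E → R}
    {ends : E → Sym2 V} {v : V} (h : SixForms p ends o a₁ a₂ v b) : FourForms p ends o a₁ a₂ v b :=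
  ⟨h.1, h.2.1, h.2.2.2.1, h.2.2.2.2.1⟩

omit [IsStrictOrderedRing R] in
/-- **`ClosedAtT` implies `ClosedAt`.** -/
theorem closedAt_of_closedAtT {E : Type u} [Fintype E] [DecidableEq E] {ends : E → Sym2 V} {v : V}
    (h : ClosedAtT (R := R) o a₁ a₂ b E ends v) : ClosedAt R o a₁ a₂ b E ends v :=
  fun p hp => fourForms_of_sixForms (h p hp)

/-- The six forms survive one thickening step. -/
theorem sixForms_of_thickStep {E' : Type u} [Fintype E'] [DecidableEq E'] {ends' : E' → Sym2 V}
    {E : Type u} [Fintype E] [DecidableEq E] {ends : E → Sym2 V} {v : V}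
    (h : ThickStep o a₁ a₂ b v E' ends' E ends) (hc : ClosedAtT (R := R) o a₁ a₂ b E' ends' v) :
    ClosedAtT (R := R) o a₁ a₂ b E ends v := by
  cases h with
  | leaf E ends u a₃ e₀ hl ho h1 h2 hv hb =>
    intro p hp
    obtain ⟨hII, hIIQ, hIIT, hI, hIQ, hIT⟩ := hc (restrictW p e₀) (IsProbVec.restrictW hp e₀)
    exact ⟨zSplitII_of_restrict p hl ho h1 h2 hv hb hII, zSplitIIQ_of_restrict p hl ho h1 h2 hv hb hIIQ,
      zSplitIIT_of_restrict p hl ho h1 h2 hv hb hIIT, zSplitI_of_restrict p hl ho h1 h2 hv hb hI,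
      zSplitIQ_of_restrict p hl ho h1 h2 hv hb hIQ, zSplitIT_of_restrict p hl ho h1 h2 hv hb hIT⟩
  | par E ends e₀ e₁ hpar hne =>
    intro p hp
    obtain ⟨hII, hIIQ, hIIT, hI, hIQ, hIT⟩ := hc (mergeW p e₀ e₁) (IsProbVec.mergeW hp e₀ e₁)
    exact ⟨zSplitII_of_merge p hpar hne hII, zSplitIIQ_of_merge p hpar hne hIIQ,
      zSplitIIT_of_merge p hpar hne hIIT, zSplitI_of_merge p hpar hne hI,
      zSplitIQ_of_merge p hpar hne hIQ, zSplitIT_of_merge p hpar hne hIT⟩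
  | series E ends x w z e₀ e₁ hs ho h1 h2 hv hb =>
    intro p hp
    obtain ⟨hII, hIIQ, hIIT, hI, hIQ, hIT⟩ := hc (seriesW p e₀ e₁) (IsProbVec.seriesW hp e₀ e₁)
    exact ⟨zSplitII_of_series p hs ho h1 h2 hv hb hII, zSplitIIQ_of_series p hs ho h1 h2 hv hb hIIQ,
      zSplitIIT_of_series p hs ho h1 h2 hv hb hIIT, zSplitI_of_series p hs ho h1 h2 hv hb hI,
      zSplitIQ_of_series p hs ho h1 h2 hv hb hIQ, zSplitIT_of_series p hs ho h1 h2 hv hb hIT⟩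
  | loop E ends x e₀ hl =>
    intro p hp
    obtain ⟨hII, hIIQ, hIIT, hI, hIQ, hIT⟩ := hc (restrictW p e₀) (IsProbVec.restrictW hp e₀)
    have h4 := fourForms_of_loop p hl ⟨hII, hIIQ, hI, hIQ⟩
    exact ⟨h4.1, h4.2.1, zSplitIIT_of_loop p hl hIIT, h4.2.2.1, h4.2.2.2, zSplitIT_of_loop p hl hIT⟩

/-- **`ClosedAtT` is closed under thickening.** -/
theorem closedAtT_of_thickening {E' : Type u} [Fintype E'] [DecidableEq E'] {ends' : E' → Sym2 V}
    {E : Type u} [Fintype E] [DecidableEq E] {ends : E → Sym2 V} {v : V}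
    (h : Thickening o a₁ a₂ b v E' ends' E ends) (hc : ClosedAtT (R := R) o a₁ a₂ b E' ends' v) :
    ClosedAtT (R := R) o a₁ a₂ b E ends v := by
  induction h with
  | refl => exact hc
  | tail _ hstep ih => exact sixForms_of_thickStep hstep ih

/-- **One move preserves the six-form closed property** (a thickening, or the pendant step through
`sixForms_of_leaf_at`). -/
theorem closedAtT_of_moveStep {E' : Type u} [Fintype E'] [DecidableEq E'] {ends' : E' → Sym2 V} {v' : V}
    {E : Type u} [Fintype E] [DecidableEq E] {ends : E → Sym2 V} {v : V}
    (h : MoveStep o a₁ a₂ b E' ends' v' E ends v) (hc : ClosedAtT (R := R) o a₁ a₂ b E' ends' v') :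
    ClosedAtT (R := R) o a₁ a₂ b E ends v := by
  cases h with
  | thick h => exact sixForms_of_thickStep h hc
  | leafMove _ _ _ _ e₀ hl ho h1 h2 hb =>
    intro p hp
    -- the six forms at the attachment vertex in `G − e₀`, then at `x` in `G`, then at the leaf
    obtain ⟨hII, hIIQ, hIIT, hI, hIQ, hIT⟩ := hc (restrictW p e₀) (IsProbVec.restrictW hp e₀)
    have hx : SixForms p ends o a₁ a₂ _ b :=
      ⟨zSplitII_of_restrict p hl ho h1 h2 hl.ne hb hII, zSplitIIQ_of_restrict p hl ho h1 h2 hl.ne hb hIIQ,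
        zSplitIIT_of_restrict p hl ho h1 h2 hl.ne hb hIIT, zSplitI_of_restrict p hl ho h1 h2 hl.ne hb hI,
        zSplitIQ_of_restrict p hl ho h1 h2 hl.ne hb hIQ, zSplitIT_of_restrict p hl ho h1 h2 hl.ne hb hIT⟩
    exact sixForms_of_leaf_at p hp hl o a₁ a₂ b ho h1 h2 hb hx

/-- **`ClosedAtT` is preserved by every sequence of moves.** -/
theorem closedAtT_of_moves {E' : Type u} [Fintype E'] [DecidableEq E'] {ends' : E' → Sym2 V} {v' : V}
    {E : Type u} [Fintype E] [DecidableEq E] {ends : E → Sym2 V} {v : V}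
    (h : Moves o a₁ a₂ b E' ends' v' E ends v) (hc : ClosedAtT (R := R) o a₁ a₂ b E' ends' v') :
    ClosedAtT (R := R) o a₁ a₂ b E ends v := by
  induction h with
  | refl => exact hc
  | tail _ hstep ih => exact closedAtT_of_moveStep hstep ih

end SixForms

/-! ## The `a₂`-edge rule for the six-form closed property -/

section A2Rule
variable {V : Type*} [Fintype V] [DecidableEq V] {R : Type*} [Field R] [LinearOrder R]
  [IsStrictOrderedRing R] {o a₁ a₂ b : V}

/-- **`ClosedAtT` is closed under the deletion of the `a₂`-edges at the statement vertex**: if the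
six forms hold for every admissible weight vector with every `a₂a₃`-edge null, they hold for every
admissible weight vector. -/
theorem closedAtT_of_a2_edges {E : Type u} [Fintype E] [DecidableEq E] {ends : E → Sym2 V} {a₃ : V}
    (hc : ∀ p : E → R, IsProbVec p → (∀ e, ends e = s(a₂, a₃) → p e = 0) →
      SixForms p ends o a₁ a₂ a₃ b) :
    ClosedAtT (R := R) o a₁ a₂ b E ends a₃ :=
  fun p hp => sixForms_of_a2Free p hp o b (fun p' hp' h0 => hc p' hp' h0)

end A2Rule

end CaseOne

end Summit.Ventures.PercRepro2
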